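import Mathlib.LinearAlgebra.Matrix.Charpoly.Disc
import Mathlib.LinearAlgebra.FiniteDimensional.Lemmas
import Mathlib.Algebra.CubicDiscriminant
import Mathlib.LinearAlgebra.Matrix.ToLin
import Literature.LinearAlgebra.Matrix.CubicDiscriminantDiagonalScaling   -- ★ `charpoly_fin_three_explicit`
import HarnessLib

/-!
# `3 × 3` matrices: homogeneity ∕ centre-invariance of the discriminant of the characteristic polynomial, and the NON-REGULAR elements
# (`(X − a•1)(X − b•1) = 0`): trichotomy, square-zero = rank one, type `(a,a,b)` spectral projectors

Topic `LinearAlgebra/Matrix`; namespace `Literature.LinearAlgebra.Matrix`.  THEOREMS ONLY (no definition, no instance, no notation, no named fact,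
no `sorry`); Mathlib + ★ `CubicDiscriminantDiagonalScaling` (`charpoly_fin_three_explicit`).  Written as brick (D4c∕d, algebra half) of the
`hodgecm-mathlib` cell's ROAD «HC-D» (local integrability of `|D_G|^{−1∕2}` on `U(3)`, crux H413 = `stmt-HodgeConjecture-24833`; count-neutral):
`η := Matrix.discr` (Mathlib: the discriminant of the characteristic polynomial) is the function whose inverse square root is integrated, and the
non-regular locus `{X | ∃ a b, (X − a•1)(X − b•1) = 0}` (complement of the regular = cyclic matrices, the predicate of the sibling brick (D4a)) is where
the Chevalley map fails to be submersive.

* §1 `η`-CALCULUS on `M₃(R)`, `R` any commutative ring: `discr_eq_of_charpoly_eq` (the cubic formula `b²c² − 4c³ − 4b³d − 27d² + 18bcd` for a matrix whose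
  characteristic polynomial is `X³ + bX² + cX + d`), `charpoly_fin_three_trace_minors_det` (`b = −tr`, `c = Σ` principal `2 × 2` minors, `d = −det`),
  **`discr_smul_fin_three`** (`η (t • Y) = t⁶ η Y`), **`discr_add_smul_one_fin_three`** (`η (Y + μ•1) = η Y`, invariance under the centre), `discr_neg_fin_three`,
  Mathlib's `Matrix.discr_conj` (`Ad`-invariance) re-exported in the `GL`-free form `discr_units_conj`, and the corollary `discr_torus_conj`
  (`η (t² • d_t⁻¹ Z d_t) = t¹² η Z` for the contracting torus `d_t = diag(t,1,t⁻¹)` of the Slodowy slice at the minimal nilpotent — sibling file `MinimalNilpotentSliceFinThree`).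
* §2 NON-REGULAR `3 × 3` MATRICES over a field `K`: `nonregular_trichotomy` (scalar ∕ `a = b` with `N = X − a•1 ≠ 0`, `N² = 0` ∕ `a ≠ b` semisimple non-scalar),
  **`exists_vecMulVec_of_mul_self_eq_zero`** (`N ≠ 0`, `N² = 0` ⇒ `N = u wᵀ` with `w ⬝ᵥ u = 0` — rank one), and for `a ≠ b` the SPECTRAL PROJECTORS
  `P_a = (b − a)⁻¹ • (b•1 − X)`, `P_b = (a − b)⁻¹ • (a•1 − X)`: idempotent, orthogonal, `P_a + P_b = 1`, `X = a • P_a + b • P_b` (`spectralProj_*`).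

## References
* [HornJohnson2013] R. A. Horn, C. R. Johnson, *Matrix Analysis*, 2nd ed. (2013), §1.2 Problem 1.2.P18 (`p_A(t) = t³ − (tr A)t² + (tr adj A)t − det A`),
  §0.4.6 (rank-one matrices `x yᵀ`). Context locator for §1–§2.
* [Humphreys1972] J. E. Humphreys, *Introduction to Lie Algebras and Representation Theory*, GTM 9 (1972), §23.2 (invariant polynomial functions; the
  discriminant as an `Ad`-invariant homogeneous polynomial). Context locator.
-/

set_option autoImplicit false

noncomputable section

open Polynomial Matrix

namespace Literature.LinearAlgebra.Matrix

/-! ## §1 `η = Matrix.discr` on `M₃(R)`: explicit formula, homogeneity, centre invariance -/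

section Discr

variable {R : Type*} [CommRing R]

/-- The discriminant of a monic cubic `X³ + bX² + cX + d` is `b²c² − 4c³ − 4b³d − 27d² + 18bcd`. [cite: HornJohnson2013, §1.2 Problem 1.2.P18] -/
theorem discr_X_pow_three_add (b c d : R) :
    (X ^ 3 + C b * X ^ 2 + C c * X + C d : R[X]).discr = b ^ 2 * c ^ 2 - 4 * c ^ 3 - 4 * b ^ 3 * d - 27 * d ^ 2 + 18 * b * c * d := by
  nontriviality R
  have hP : (X ^ 3 + C b * X ^ 2 + C c * X + C d : R[X]) = Cubic.toPoly ⟨1, b, c, d⟩ := by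
    simp only [Cubic.toPoly, map_one, one_mul]
  rw [hP, Polynomial.discr_of_degree_eq_three (Cubic.degree_of_a_ne_zero one_ne_zero)]
  simp only [Cubic.coeff_eq_a, Cubic.coeff_eq_b, Cubic.coeff_eq_c, Cubic.coeff_eq_d]
  ring

/-- `η` of a `3 × 3` matrix from its characteristic polynomial written as `X³ + bX² + cX + d`. [cite: HornJohnson2013, §1.2 Problem 1.2.P18] -/
theorem discr_eq_of_charpoly_eq {Y : Matrix (Fin 3) (Fin 3) R} {b c d : R} (h : Y.charpoly = X ^ 3 + C b * X ^ 2 + C c * X + C d) :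
    Matrix.discr Y = b ^ 2 * c ^ 2 - 4 * c ^ 3 - 4 * b ^ 3 * d - 27 * d ^ 2 + 18 * b * c * d := by
  rw [Matrix.discr, h, discr_X_pow_three_add]

/-- `χ_Y = X³ − (tr Y) X² + e₂(Y) X − det Y` with `e₂` the sum of the three principal `2 × 2` minors. [cite: HornJohnson2013, §1.2 Problem 1.2.P18] -/
theorem charpoly_fin_three_trace_minors_det (Y : Matrix (Fin 3) (Fin 3) R) :
    Y.charpoly = X ^ 3 + C (-Y.trace) * X ^ 2 +
      C ((Y 0 0 * Y 1 1 - Y 0 1 * Y 1 0) + (Y 0 0 * Y 2 2 - Y 0 2 * Y 2 0) + (Y 1 1 * Y 2 2 - Y 1 2 * Y 2 1)) * X + C (-Y.det) := by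
  rw [charpoly_fin_three_explicit, Matrix.trace_fin_three, Matrix.det_fin_three]

/-- **Homogeneity**: `η (t • Y) = t⁶ · η Y` on `M₃(R)`. [cite: Humphreys1972, §23.2] -/
theorem discr_smul_fin_three (t : R) (Y : Matrix (Fin 3) (Fin 3) R) : Matrix.discr (t • Y) = t ^ 6 * Matrix.discr Y := by
  rw [discr_eq_of_charpoly_eq (charpoly_fin_three_trace_minors_det (t • Y)),
    discr_eq_of_charpoly_eq (charpoly_fin_three_trace_minors_det Y)]
  simp only [Matrix.trace_smul, Matrix.det_smul, Matrix.smul_apply, smul_eq_mul, Fintype.card_fin]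
  ring

/-- `η (−Y) = η Y`. [cite: Humphreys1972, §23.2] -/
theorem discr_neg_fin_three (Y : Matrix (Fin 3) (Fin 3) R) : Matrix.discr (-Y) = Matrix.discr Y := by
  rw [← neg_one_smul R Y, discr_smul_fin_three]
  ring

/-- **Centre invariance**: `η (Y + μ • 1) = η Y` (the roots shift by `μ`, their differences do not). [cite: Humphreys1972, §23.2] -/
theorem discr_add_smul_one_fin_three (Y : Matrix (Fin 3) (Fin 3) R) (μ : R) :
    Matrix.discr (Y + μ • (1 : Matrix (Fin 3) (Fin 3) R)) = Matrix.discr Y := by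
  rw [discr_eq_of_charpoly_eq (charpoly_fin_three_explicit (Y + μ • (1 : Matrix (Fin 3) (Fin 3) R))),
    discr_eq_of_charpoly_eq (charpoly_fin_three_explicit Y)]
  simp only [Matrix.add_apply, Matrix.smul_apply, smul_eq_mul, Matrix.one_apply_eq, Matrix.one_apply_ne (by decide : (0 : Fin 3) ≠ 1),
    Matrix.one_apply_ne (by decide : (0 : Fin 3) ≠ 2), Matrix.one_apply_ne (by decide : (1 : Fin 3) ≠ 0), Matrix.one_apply_ne (by decide : (1 : Fin 3) ≠ 2),
    Matrix.one_apply_ne (by decide : (2 : Fin 3) ≠ 0), Matrix.one_apply_ne (by decide : (2 : Fin 3) ≠ 1), mul_one, mul_zero, add_zero]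
  ring

/-- `η (Y − μ • 1) = η Y`. [cite: Humphreys1972, §23.2] -/
theorem discr_sub_smul_one_fin_three (Y : Matrix (Fin 3) (Fin 3) R) (μ : R) :
    Matrix.discr (Y - μ • (1 : Matrix (Fin 3) (Fin 3) R)) = Matrix.discr Y := by
  rw [sub_eq_add_neg, ← neg_smul, discr_add_smul_one_fin_three]

/-- `Ad`-invariance in `GL`-free form: `η (P Y P⁻¹) = η Y` for `P` with `IsUnit P.det` (Mathlib `Matrix.discr_conj`). [cite: Humphreys1972, §23.2] -/
theorem discr_units_conj {n : Type*} [Fintype n] [DecidableEq n] (P Y : Matrix n n R) (hP : IsUnit P.det) :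
    Matrix.discr (P * Y * P⁻¹) = Matrix.discr Y := by
  have hP' : IsUnit P := (Matrix.isUnit_iff_isUnit_det P).mpr hP
  obtain ⟨g, hg⟩ : ∃ g : GL n R, g.val = P := ⟨hP'.unit, hP'.unit_spec⟩
  rw [← hg]
  exact Matrix.discr_conj g Y

/-- `η`-HOMOGENEITY ALONG `ρ_t`: `Matrix.discr (ρ_t Z) = t¹² · Matrix.discr Z` for EVERY `Z` (`η` is homogeneous of degree `6` and `Ad`-invariant).
[cite: Humphreys1972, §23.2] -/
theorem discr_torus_conj (t : Rˣ) (Z : Matrix (Fin 3) (Fin 3) R) :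
    Matrix.discr (((t : R) ^ 2) • (diagonal ![(↑t⁻¹ : R), 1, ↑t] * Z * diagonal ![(↑t : R), 1, ↑t⁻¹])) = (t : R) ^ 12 * Matrix.discr Z := by
  have hdet : IsUnit (diagonal ![(↑t⁻¹ : R), 1, ↑t]).det := by
    rw [Matrix.det_diagonal, Fin.prod_univ_three]
    simp only [Matrix.cons_val_zero, Matrix.cons_val_one, Matrix.cons_val_two, Matrix.tail_cons, Matrix.head_cons, mul_one]
    exact (Units.isUnit t⁻¹).mul (Units.isUnit t)
  have hinv : (diagonal ![(↑t⁻¹ : R), 1, ↑t])⁻¹ = diagonal ![(↑t : R), 1, ↑t⁻¹] := by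
    refine Matrix.inv_eq_right_inv ?_
    rw [Matrix.diagonal_mul_diagonal, ← Matrix.diagonal_one]
    congr 1
    ext i
    fin_cases i <;> simp
  rw [discr_smul_fin_three, ← hinv, discr_units_conj _ _ hdet]
  ring

end Discr

/-! ## §2 Non-regular `3 × 3` matrices over a field -/

section NonRegular

variable {K : Type*} [Field K]

/-- The two factors commute: `(X − a•1)(X − b•1) = 0 ↔ (X − b•1)(X − a•1) = 0`. [cite: HornJohnson2013, §1.2 Problem 1.2.P18] -/
theorem sub_smul_one_mul_comm (X : Matrix (Fin 3) (Fin 3) K) (a b : K) :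
    (X - a • (1 : Matrix (Fin 3) (Fin 3) K)) * (X - b • 1) = (X - b • 1) * (X - a • 1) := by
  simp only [sub_mul, mul_sub, Matrix.mul_smul, Matrix.smul_mul, Matrix.mul_one, Matrix.one_mul, smul_smul, mul_comm a b]
  abel

/-- **Trichotomy of non-regular matrices**: if `(X − a•1)(X − b•1) = 0` then `X` is scalar, or `a = b` and `N := X − a•1` is a non-zero square-zero matrix,
or `a ≠ b` and `X` is a non-scalar semisimple matrix killed by `(X − a•1)(X − b•1)` (type `(a,a,b)` or `(a,b,b)`). [cite: HornJohnson2013, §1.2 Problem 1.2.P18] -/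
theorem nonregular_trichotomy {X : Matrix (Fin 3) (Fin 3) K} {a b : K} (h : (X - a • (1 : Matrix (Fin 3) (Fin 3) K)) * (X - b • 1) = 0) :
    (∃ a' : K, X = a' • 1) ∨
      (a = b ∧ X - a • 1 ≠ 0 ∧ (X - a • (1 : Matrix (Fin 3) (Fin 3) K)) * (X - a • 1) = 0) ∨
      (a ≠ b ∧ ∀ a' : K, X ≠ a' • 1) := by
  by_cases hs : ∃ a' : K, X = a' • 1
  · exact Or.inl hs
  push Not at hs
  by_cases hab : a = b
  · subst hab
    exact Or.inr (Or.inl ⟨rfl, fun h0 => hs a (sub_eq_zero.mp h0), h⟩)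
  · exact Or.inr (Or.inr ⟨hab, hs⟩)

/-- Converse bookkeeping: `(u wᵀ)² = (w ⬝ᵥ u) • u wᵀ`, so `u wᵀ` is square-zero iff `w ⬝ᵥ u = 0` or it vanishes. [cite: HornJohnson2013, §0.4.6] -/
theorem vecMulVec_mul_vecMulVec_self {m : Type*} [Fintype m] {S : Type*} [CommRing S] (u w : m → S) :
    vecMulVec u w * vecMulVec u w = (w ⬝ᵥ u) • vecMulVec u w := by
  ext i j
  simp only [Matrix.mul_apply, Matrix.vecMulVec_apply, Matrix.smul_apply, smul_eq_mul, dotProduct, Finset.sum_mul]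
  exact Finset.sum_congr rfl fun k _ => by ring

/-- A square-zero `u wᵀ` with `u ≠ 0`, `w ≠ 0` has `w ⬝ᵥ u = 0`. [cite: HornJohnson2013, §0.4.6] -/
theorem dotProduct_eq_zero_of_vecMulVec_sq_eq_zero {m : Type*} [Fintype m] {u w : m → K} (hu : u ≠ 0) (hw : w ≠ 0)
    (h : vecMulVec u w * vecMulVec u w = 0) : w ⬝ᵥ u = 0 := by
  have hne : vecMulVec u w ≠ 0 := by
    intro h0
    obtain ⟨i, hi⟩ := Function.ne_iff.mp hu
    obtain ⟨j, hj⟩ := Function.ne_iff.mp hw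
    have hij := congrFun (congrFun h0 i) j
    simp only [Matrix.vecMulVec_apply, Matrix.zero_apply, mul_eq_zero] at hij
    exact hij.elim hi hj
  rw [vecMulVec_mul_vecMulVec_self] at h
  exact (smul_eq_zero.mp h).resolve_right hne

/-- **Square-zero, non-zero `3 × 3` matrices have rank one**: `N = u wᵀ` with `u, w ≠ 0` and `w ⬝ᵥ u = 0` (rank–nullity: `range N ≤ ker N`).
[cite: HornJohnson2013, §0.4.6] -/
theorem exists_vecMulVec_of_mul_self_eq_zero {N : Matrix (Fin 3) (Fin 3) K} (hN : N ≠ 0) (h2 : N * N = 0) :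
    ∃ u w : Fin 3 → K, u ≠ 0 ∧ w ≠ 0 ∧ N = vecMulVec u w ∧ w ⬝ᵥ u = 0 := by
  classical
  -- `f = N·` has `range f ≤ ker f` (square zero), hence `finrank (range f) ≤ 1` by rank–nullity in dimension `3`
  set f : (Fin 3 → K) →ₗ[K] (Fin 3 → K) := Matrix.mulVecLin N with hf
  have hrk : LinearMap.range f ≤ LinearMap.ker f := by
    rintro _ ⟨x, rfl⟩
    rw [LinearMap.mem_ker, hf, Matrix.mulVecLin_apply, Matrix.mulVecLin_apply, Matrix.mulVec_mulVec, h2, Matrix.zero_mulVec]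
  have hsum := LinearMap.finrank_range_add_finrank_ker f
  have h3 : Module.finrank K (Fin 3 → K) = 3 := by simp
  have hle := Submodule.finrank_mono hrk
  have hr1 : Module.finrank K (LinearMap.range f) ≤ 1 := by omega
  -- a non-zero column `u` of `N`
  obtain ⟨i₀, j₀, hij⟩ : ∃ i j, N i j ≠ 0 := by
    by_contra hc
    push Not at hc
    exact hN (Matrix.ext hc)
  have hcol : ∀ j, (fun i => N i j) ∈ LinearMap.range f := fun j =>
    ⟨Pi.single j 1, by
      rw [hf, Matrix.mulVecLin_apply]
      ext i
      rw [Matrix.mulVec_single_one]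
      rfl⟩
  have hu0 : (fun i => N i j₀) ≠ 0 := fun h0 => hij (by simpa using congrFun h0 i₀)
  -- `range f` is generated by one vector, necessarily a unit multiple of `u`
  obtain ⟨v, hv⟩ := finrank_le_one_iff.mp hr1
  obtain ⟨c₀, hc₀⟩ := hv ⟨_, hcol j₀⟩
  have e0 : c₀ • (v : Fin 3 → K) = fun i => N i j₀ := by simpa using congrArg Subtype.val hc₀
  have hc₀0 : c₀ ≠ 0 := by
    rintro rfl
    exact hu0 (by rw [← e0, zero_smul])
  have hw : ∀ j, ∃ c : K, (fun i => N i j) = c • fun i => N i j₀ := by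
    intro j
    obtain ⟨c, hc⟩ := hv ⟨_, hcol j⟩
    have e1 : c • (v : Fin 3 → K) = fun i => N i j := by simpa using congrArg Subtype.val hc
    refine ⟨c * c₀⁻¹, ?_⟩
    rw [← e1, ← e0, smul_smul, mul_assoc, inv_mul_cancel₀ hc₀0, mul_one]
  choose w hw using hw
  have hN' : N = vecMulVec (fun i => N i j₀) w := by
    ext i j
    have hij' := congrFun (hw j) i
    simp only [Pi.smul_apply, smul_eq_mul] at hij'
    rw [Matrix.vecMulVec_apply, hij', mul_comm]
  have hw0 : w ≠ 0 := by
    intro h0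
    apply hN
    rw [hN', h0]
    ext i j
    simp [Matrix.vecMulVec_apply]
  refine ⟨fun i => N i j₀, w, hu0, hw0, hN', ?_⟩
  exact dotProduct_eq_zero_of_vecMulVec_sq_eq_zero hu0 hw0 (by rw [← hN']; exact h2)

/-- Type `(a,a,b)`, `a ≠ b`: the spectral projector `P_a := (b − a)⁻¹ • (b•1 − X)` is idempotent. [cite: HornJohnson2013, §1.2 Problem 1.2.P18] -/
theorem spectralProj_mul_self {X : Matrix (Fin 3) (Fin 3) K} {a b : K} (hab : a ≠ b)
    (h : (X - a • (1 : Matrix (Fin 3) (Fin 3) K)) * (X - b • 1) = 0) :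
    ((b - a)⁻¹ • (b • (1 : Matrix (Fin 3) (Fin 3) K) - X)) * ((b - a)⁻¹ • (b • 1 - X)) = (b - a)⁻¹ • (b • 1 - X) := by
  have hba : b - a ≠ 0 := sub_ne_zero.mpr (Ne.symm hab)
  have hXX : X * X = (a + b) • X - (a * b) • (1 : Matrix (Fin 3) (Fin 3) K) := by
    have h' := h
    simp only [sub_mul, mul_sub, Matrix.mul_smul, Matrix.smul_mul, Matrix.mul_one, Matrix.one_mul, smul_smul] at h'
    rw [← sub_eq_zero, ← h']
    module
  -- `(b•1 − X)² = (b − a) • (b•1 − X)`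
  have key : (b • (1 : Matrix (Fin 3) (Fin 3) K) - X) * (b • 1 - X) = (b - a) • (b • 1 - X) := by
    simp only [sub_mul, mul_sub, Matrix.mul_smul, Matrix.smul_mul, Matrix.mul_one, Matrix.one_mul, smul_smul, hXX]
    module
  rw [smul_mul_smul_comm, key, smul_smul, mul_assoc, inv_mul_cancel₀ hba, mul_one]

/-- The two spectral projectors are orthogonal: `P_a P_b = 0`. [cite: HornJohnson2013, §1.2 Problem 1.2.P18] -/
theorem spectralProj_mul_other {X : Matrix (Fin 3) (Fin 3) K} {a b : K}
    (h : (X - a • (1 : Matrix (Fin 3) (Fin 3) K)) * (X - b • 1) = 0) :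
    ((b - a)⁻¹ • (b • (1 : Matrix (Fin 3) (Fin 3) K) - X)) * ((a - b)⁻¹ • (a • 1 - X)) = 0 := by
  rw [smul_mul_smul_comm]
  have : (b • (1 : Matrix (Fin 3) (Fin 3) K) - X) * (a • 1 - X) = (X - a • 1) * (X - b • 1) := by
    rw [sub_smul_one_mul_comm]
    simp only [sub_mul, mul_sub, Matrix.mul_smul, Matrix.smul_mul, Matrix.mul_one, Matrix.one_mul, smul_smul]
    abel
  rw [this, h, smul_zero]

/-- `P_a + P_b = 1`. [cite: HornJohnson2013, §1.2 Problem 1.2.P18] -/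
theorem spectralProj_add {X : Matrix (Fin 3) (Fin 3) K} {a b : K} (hab : a ≠ b) :
    (b - a)⁻¹ • (b • (1 : Matrix (Fin 3) (Fin 3) K) - X) + (a - b)⁻¹ • (a • 1 - X) = 1 := by
  have hba : b - a ≠ 0 := sub_ne_zero.mpr (Ne.symm hab)
  have hab' : a - b ≠ 0 := sub_ne_zero.mpr hab
  have e : (a - b)⁻¹ = -(b - a)⁻¹ := by rw [← inv_neg, neg_sub]
  rw [e, neg_smul, ← sub_eq_add_neg, ← smul_sub, sub_sub_sub_cancel_right, ← sub_smul, smul_smul, inv_mul_cancel₀ hba, one_smul]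

/-- `X = a • P_a + b • P_b`. [cite: HornJohnson2013, §1.2 Problem 1.2.P18] -/
theorem eq_smul_spectralProj_add {X : Matrix (Fin 3) (Fin 3) K} {a b : K} (hab : a ≠ b) :
    X = a • ((b - a)⁻¹ • (b • (1 : Matrix (Fin 3) (Fin 3) K) - X)) + b • ((a - b)⁻¹ • (a • 1 - X)) := by
  have hba : b - a ≠ 0 := sub_ne_zero.mpr (Ne.symm hab)
  have e : (a - b)⁻¹ = -(b - a)⁻¹ := by rw [← inv_neg, neg_sub]
  rw [e]
  have key : a • (b • (1 : Matrix (Fin 3) (Fin 3) K) - X) - b • (a • 1 - X) = (b - a) • X := by module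
  calc X = (b - a)⁻¹ • ((b - a) • X) := by rw [smul_smul, inv_mul_cancel₀ hba, one_smul]
    _ = (b - a)⁻¹ • (a • (b • (1 : Matrix (Fin 3) (Fin 3) K) - X) - b • (a • 1 - X)) := by rw [key]
    _ = a • ((b - a)⁻¹ • (b • (1 : Matrix (Fin 3) (Fin 3) K) - X)) + b • (-(b - a)⁻¹ • (a • 1 - X)) := by module

/-- `X P_a = a • P_a` (the range of `P_a` is the `a`-eigenspace; for `a = b` both sides vanish, so `a ≠ b` is not needed). [cite: HornJohnson2013, §1.2 Problem 1.2.P18] -/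
theorem mul_spectralProj {X : Matrix (Fin 3) (Fin 3) K} {a b : K}
    (h : (X - a • (1 : Matrix (Fin 3) (Fin 3) K)) * (X - b • 1) = 0) :
    X * ((b - a)⁻¹ • (b • (1 : Matrix (Fin 3) (Fin 3) K) - X)) = a • ((b - a)⁻¹ • (b • 1 - X)) := by
  rw [Matrix.mul_smul, smul_comm a (b - a)⁻¹ (b • (1 : Matrix (Fin 3) (Fin 3) K) - X)]
  congr 1
  -- `X (b•1 − X) = a • (b•1 − X)` ⟺ `−(X − a•1)(X − b•1) = 0`
  have key : X * (b • (1 : Matrix (Fin 3) (Fin 3) K) - X) - a • (b • 1 - X) = -((X - a • 1) * (X - b • 1)) := by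
    simp only [sub_mul, mul_sub, Matrix.mul_smul, Matrix.smul_mul, Matrix.mul_one, Matrix.one_mul, smul_smul, smul_sub, mul_comm a b]
    abel
  rw [← sub_eq_zero, key, h, neg_zero]

/-- A matrix commutes with `X` iff it commutes with `P_a` (for `a ≠ b`): the centraliser of a type-`(a,a,b)` element is the block algebra of the
eigenspace decomposition. [cite: HornJohnson2013, §1.2 Problem 1.2.P18] -/
theorem commute_iff_commute_spectralProj {X Z : Matrix (Fin 3) (Fin 3) K} {a b : K} (hab : a ≠ b) :
    Z * X = X * Z ↔ Z * ((b - a)⁻¹ • (b • (1 : Matrix (Fin 3) (Fin 3) K) - X)) = ((b - a)⁻¹ • (b • 1 - X)) * Z := by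
  have hba : b - a ≠ 0 := sub_ne_zero.mpr (Ne.symm hab)
  constructor
  · intro hc
    rw [Matrix.mul_smul, Matrix.smul_mul, mul_sub, sub_mul, Matrix.mul_smul, Matrix.smul_mul, Matrix.mul_one, Matrix.one_mul, hc]
  · intro hc
    rw [Matrix.mul_smul, Matrix.smul_mul] at hc
    have hc' := smul_right_injective (Matrix (Fin 3) (Fin 3) K) ((inv_ne_zero hba)) hc
    rw [mul_sub, sub_mul, Matrix.mul_smul, Matrix.smul_mul, Matrix.mul_one, Matrix.one_mul] at hc'
    exact (sub_right_inj.mp hc').symm ▸ rfl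

/-- In the non-scalar case both projectors are non-zero: if `a ≠ b` and `X` is not scalar then `P_a ≠ 0` and `P_b ≠ 0` (no use of the
annihilating relation).
[cite: HornJohnson2013, §1.2 Problem 1.2.P18] -/
theorem spectralProj_ne_zero {X : Matrix (Fin 3) (Fin 3) K} {a b : K} (hab : a ≠ b) (hX : ∀ a' : K, X ≠ a' • 1) :
    (b - a)⁻¹ • (b • (1 : Matrix (Fin 3) (Fin 3) K) - X) ≠ 0 ∧ (a - b)⁻¹ • (a • (1 : Matrix (Fin 3) (Fin 3) K) - X) ≠ 0 := by
  have hba : b - a ≠ 0 := sub_ne_zero.mpr (Ne.symm hab)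
  have hab' : a - b ≠ 0 := sub_ne_zero.mpr hab
  constructor
  · intro h0
    rw [smul_eq_zero, sub_eq_zero] at h0
    rcases h0 with h0 | h0
    · exact (inv_ne_zero hba) h0
    · exact hX b h0.symm
  · intro h0
    rw [smul_eq_zero, sub_eq_zero] at h0
    rcases h0 with h0 | h0
    · exact (inv_ne_zero hab') h0
    · exact hX a h0.symm

end NonRegular

end Literature.LinearAlgebra.Matrix

end
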